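import Mathlib

/-!
# Route `SymPencil` — tools for the homogeneity drop (cruxes `SdcPerSq` stmt-ValiantsHypothesis-5675,
# `SdcPerBeyondN` stmt-ValiantsHypothesis-5676)

Elementary one-variable polynomial and block-matrix bookkeeping used by
`SymPencilHomogeneousDrop.lean` (the normal-form core lemma) and
`SymPencilHomogeneousHessianRank.lean` (the rank bound `rank Hess f (x) ≤ m` for homogeneous
`f = det` of a symmetric affine pencil of size `m ≠ deg f`):

* `eval_detLine`, `coeff_detLine_zero`, `coeff_detLine_one`: the polynomial `det (A + X • N)`,
  its value `det (A + ε N)` at `ε`, its constant term `det A` and — for invertible `A` — its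
  linear term `det A · tr (A⁻¹ N)` (from Mathlib's `Matrix.det_one_add_X_smul`);
* `coeff_eq_of_det_add_smul_eq`: two such families agreeing off a finite set of `ε` agree to
  first order (`Polynomial.eq_of_infinite_eval_eq`);
* `eq_zero_of_quadratic_form_eq_zero` (polarisation), `trace_mul_vecMulVec`,
  `det_fromBlocks_smul_one₁₁` / `det_fromBlocks_corner` (Schur complement of an invertible scalar
  corner), and the block identities `eq_fromBlocks_of_col`, `fromBlocks_add_smul_add_smul`,
  `fromBlocks_add_smul`, `inv_smul_vecMulVec_smul` for matrices on `Unit ⊕ ι'`.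

All statements are folklore linear algebra. [folklore]
-/

noncomputable section

-- single-conjunct layout: Sub = Summit, duplicated namespace component intended
set_option linter.dupNamespace false

namespace Summit.ValiantsHypothesis.ValiantsHypothesis.Theorems.SymPencilHomogeneousDropTools

open Matrix Polynomial

universe u

variable {k : Type u} [Field k]

/-! ### One-variable polynomial tools: `det (A + ε N)` as a polynomial in `ε` -/

section PolyTools

variable {ι : Type*} [Fintype ι] [DecidableEq ι]

/-- Evaluating the polynomial `det (A + X • N)` at `ε` gives `det (A + ε • N)`. [folklore] -/
theorem eval_detLine (A N : Matrix ι ι k) (ε : k) :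
    (A.map Polynomial.C + (Polynomial.X : k[X]) • N.map Polynomial.C).det.eval ε =
      (A + ε • N).det := by
  rw [← Polynomial.coe_evalRingHom, RingHom.map_det]
  congr 1
  ext i j
  simp [Matrix.map_apply]
  ring

/-- The constant coefficient of `det (A + X • N)` is `det A`. [folklore] -/
theorem coeff_detLine_zero (A N : Matrix ι ι k) :
    (A.map Polynomial.C + (Polynomial.X : k[X]) • N.map Polynomial.C).det.coeff 0 = A.det := by
  rw [Polynomial.coeff_zero_eq_eval_zero, eval_detLine, zero_smul, add_zero]

/-- For invertible `A`, `det (A + X • N) = C (det A) * det (1 + X • (A⁻¹ N))`. [folklore] -/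
theorem detLine_eq_of_isUnit {A : Matrix ι ι k} (hA : IsUnit A.det) (N : Matrix ι ι k) :
    (A.map Polynomial.C + (Polynomial.X : k[X]) • N.map Polynomial.C).det = Polynomial.C A.det *
      (1 + (Polynomial.X : k[X]) • (A⁻¹ * N).map Polynomial.C).det := by
  have hfac : A.map Polynomial.C + (Polynomial.X : k[X]) • N.map Polynomial.C =
      A.map Polynomial.C * (1 + (Polynomial.X : k[X]) • (A⁻¹ * N).map Polynomial.C) := by
    rw [Matrix.mul_add, Matrix.mul_one, Matrix.mul_smul, ← Matrix.map_mul,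
      ← Matrix.mul_assoc, Matrix.mul_nonsing_inv _ hA, Matrix.one_mul]
  rw [hfac, Matrix.det_mul]
  congr 1
  rw [← RingHom.mapMatrix_apply, ← RingHom.map_det]

/-- For invertible `A`, the coefficient of `ε` in `det (A + ε N)` is `det A · tr (A⁻¹ N)`.
[folklore] -/
theorem coeff_detLine_one {A : Matrix ι ι k} (hA : IsUnit A.det) (N : Matrix ι ι k) :
    (A.map Polynomial.C + (Polynomial.X : k[X]) • N.map Polynomial.C).det.coeff 1 =
      A.det * (A⁻¹ * N).trace := by
  rw [detLine_eq_of_isUnit hA, Polynomial.coeff_C_mul, Matrix.det_one_add_X_smul,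
    Polynomial.coeff_add, Polynomial.coeff_add, Polynomial.coeff_one,
    Polynomial.coeff_mul_X_pow', Polynomial.smul_eq_C_mul, Polynomial.coeff_C_mul,
    Polynomial.coeff_X_one]
  simp

/-- The constant coefficient of `(1 + C μ X) ^ j` is `1`. [folklore] -/
theorem coeff_one_add_pow_zero (μ : k) (j : ℕ) :
    ((1 + Polynomial.C μ * Polynomial.X : k[X]) ^ j).coeff 0 = 1 := by
  induction j with
  | zero => simp
  | succ j ih => rw [pow_succ, Polynomial.mul_coeff_zero, ih]; simp

/-- The coefficient of `X` in `(1 + C μ X) ^ j` is `j μ`. [folklore] -/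
theorem coeff_one_add_pow_one (μ : k) (j : ℕ) :
    ((1 + Polynomial.C μ * Polynomial.X : k[X]) ^ j).coeff 1 = j * μ := by
  induction j with
  | zero => simp [Polynomial.coeff_one]
  | succ j ih =>
      rw [pow_succ, mul_add, mul_one, Polynomial.coeff_add, ih, ← mul_assoc,
        Polynomial.coeff_mul_X, Polynomial.coeff_mul_C, coeff_one_add_pow_zero]
      push_cast
      ring

/-- If `det (A + ε N₁) = c · (1 + μ ε) ^ j · det (B + ε N₂)` for all `ε` off a finite set, then
the two sides agree as polynomials in `ε`; we record the two consequences we need: the constant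
terms agree and the first-order terms agree. [folklore] -/
theorem coeff_eq_of_det_add_smul_eq [Infinite k] {A B N₁ N₂ : Matrix ι ι k} {c μ : k} {j : ℕ}
    (S : Finset k)
    (h : ∀ ε : k, ε ∉ S → (A + ε • N₁).det = c * (1 + μ * ε) ^ j * (B + ε • N₂).det) :
    A.det = c * B.det ∧
      (A.map Polynomial.C + (Polynomial.X : k[X]) • N₁.map Polynomial.C).det.coeff 1 =
        c * (j * μ * B.det +
          (B.map Polynomial.C + (Polynomial.X : k[X]) • N₂.map Polynomial.C).det.coeff 1) := by
  set p : k[X] := (A.map Polynomial.C + (Polynomial.X : k[X]) • N₁.map Polynomial.C).det with hp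
  set q₀ : k[X] := (B.map Polynomial.C + (Polynomial.X : k[X]) • N₂.map Polynomial.C).det with hq₀
  set q : k[X] := Polynomial.C c * ((1 + Polynomial.C μ * Polynomial.X) ^ j * q₀) with hq
  have hpq : p = q := by
    apply Polynomial.eq_of_infinite_eval_eq
    refine Set.Infinite.mono (s := {ε : k | ε ∉ S}) (fun ε hε => ?_)
      (Finset.finite_toSet S).infinite_compl
    simp only [Set.mem_setOf_eq] at hε ⊢
    rw [hp, hq, eval_detLine, Polynomial.eval_mul, Polynomial.eval_mul, hq₀, eval_detLine, h ε hε]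
    simp [mul_assoc]
  refine ⟨?_, ?_⟩
  · have h0 := congr_arg (fun r : k[X] => r.coeff 0) hpq
    simp only [hp, hq, hq₀, Polynomial.mul_coeff_zero, coeff_detLine_zero,
      coeff_one_add_pow_zero, one_mul, Polynomial.coeff_C_zero] at h0
    exact h0
  · have h1 := congr_arg (fun r : k[X] => r.coeff 1) hpq
    simp only [hq, Polynomial.coeff_C_mul] at h1
    rw [h1, Polynomial.coeff_mul, Finset.Nat.antidiagonal_succ, Finset.sum_cons,
      Finset.Nat.antidiagonal_zero, Finset.map_singleton, Finset.sum_singleton]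
    simp only [Function.Embedding.coe_prodMap, Function.Embedding.coeFn_mk, Prod.map_apply,
      Nat.succ_eq_add_one, zero_add, Function.Embedding.refl_apply]
    rw [coeff_one_add_pow_zero, coeff_one_add_pow_one, hq₀, coeff_detLine_zero]
    ring

end PolyTools

/-! ### Small matrix tools -/

section MatrixTools

variable {ι : Type*} [Fintype ι] [DecidableEq ι]

/-- A symmetric matrix whose quadratic form vanishes identically is zero (`2 ≠ 0`). [folklore] -/
theorem eq_zero_of_quadratic_form_eq_zero [NeZero (2 : k)] {N : Matrix ι ι k} (hN : Nᵀ = N)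
    (h : ∀ b : ι → k, b ⬝ᵥ N *ᵥ b = 0) : N = 0 := by
  have hsingle : ∀ i j : ι, (Pi.single i (1 : k)) ⬝ᵥ N *ᵥ (Pi.single j 1) = N i j := by
    intro i j
    rw [Matrix.mulVec_single_one, single_one_dotProduct, Matrix.col_apply]
  have hsymm : ∀ i j, N i j = N j i := fun i j => by
    rw [← hN, Matrix.transpose_apply, hN]
  ext i j
  have h1 := h (Pi.single i 1)
  have h2 := h (Pi.single j 1)
  have h3 := h (Pi.single i 1 + Pi.single j 1)
  rw [Matrix.mulVec_add, dotProduct_add, add_dotProduct, add_dotProduct, hsingle, hsingle,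
    hsingle, hsingle] at h3
  rw [hsingle] at h1 h2
  rw [h1, h2, hsymm j i, zero_add, add_zero] at h3
  have h4 : (2 : k) * N i j = 0 := by rw [two_mul]; exact h3
  rw [Matrix.zero_apply]
  exact (mul_eq_zero.1 h4).resolve_left (NeZero.ne 2)

omit [DecidableEq ι] in
/-- `tr (P · u vᵀ) = (P u) ⬝ v`. [folklore] -/
theorem trace_mul_vecMulVec (P : Matrix ι ι k) (u v : ι → k) :
    (P * Matrix.vecMulVec u v).trace = P *ᵥ u ⬝ᵥ v := by
  rw [Matrix.mul_vecMulVec, Matrix.trace_vecMulVec]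

/-- **Schur complement of an invertible scalar corner.** For `c ≠ 0`,
`det [[c • 1, B], [C, D]] = c ^ |m| · det (D - c⁻¹ • C B)`. [folklore] -/
theorem det_fromBlocks_smul_one₁₁ {m n : Type*} [Fintype m] [DecidableEq m] [Fintype n]
    [DecidableEq n] {c : k} (hc : c ≠ 0) (B : Matrix m n k) (C : Matrix n m k)
    (D : Matrix n n k) :
    (Matrix.fromBlocks (c • (1 : Matrix m m k)) B C D).det =
      c ^ Fintype.card m * (D - c⁻¹ • (C * B)).det := by
  letI : Invertible (c • (1 : Matrix m m k)) :=
    { invOf := c⁻¹ • (1 : Matrix m m k)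
      invOf_mul_self := by
        rw [Matrix.smul_mul, Matrix.mul_smul, Matrix.one_mul, smul_smul, inv_mul_cancel₀ hc,
          one_smul]
      mul_invOf_self := by
        rw [Matrix.smul_mul, Matrix.mul_smul, Matrix.one_mul, smul_smul, mul_inv_cancel₀ hc,
          one_smul] }
  have hinv : ⅟(c • (1 : Matrix m m k)) = c⁻¹ • (1 : Matrix m m k) := rfl
  rw [Matrix.det_fromBlocks₁₁, hinv, Matrix.det_smul, Matrix.det_one, mul_one,
    Matrix.mul_smul, Matrix.mul_one, Matrix.smul_mul]

end MatrixTools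

/-! ### Block bookkeeping in the normal form `Unit ⊕ ι'` -/

section Blocks

variable {ι' : Type*}

/-- A symmetric matrix on `Unit ⊕ ι'` is the block matrix of its corner, its first column and its
lower-right block. [folklore] -/
theorem eq_fromBlocks_of_col {N : Matrix (Unit ⊕ ι') (Unit ⊕ ι') k} (hN : Nᵀ = N) {a : k}
    {b : ι' → k} (ha : N (Sum.inl ()) (Sum.inl ()) = a)
    (hb : ∀ i, N (Sum.inr i) (Sum.inl ()) = b i) :
    N = Matrix.fromBlocks (a • (1 : Matrix Unit Unit k)) (Matrix.replicateRow Unit b)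
      (Matrix.replicateCol Unit b) N.toBlocks₂₂ := by
  ext (i | i) (j | j)
  · simp [ha]
  · have h : N (Sum.inl ()) (Sum.inr j) = N (Sum.inr j) (Sum.inl ()) := by
      rw [← hN, Matrix.transpose_apply, hN]
    simp [h, hb]
  · simp [hb]
  · simp [Matrix.toBlocks₂₂]

/-- The two-parameter family `D + ε M + ν A₀` in block form. [folklore] -/
theorem fromBlocks_add_smul_add_smul (Δ C E : Matrix ι' ι' k) (a α ε ν : k) (b w : ι' → k) :
    Matrix.fromBlocks (0 : Matrix Unit Unit k) 0 0 Δ +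
        ε • Matrix.fromBlocks (a • (1 : Matrix Unit Unit k)) (Matrix.replicateRow Unit b)
          (Matrix.replicateCol Unit b) C +
        ν • Matrix.fromBlocks (α • (1 : Matrix Unit Unit k)) (Matrix.replicateRow Unit w)
          (Matrix.replicateCol Unit w) E =
      Matrix.fromBlocks ((ε * a + ν * α) • (1 : Matrix Unit Unit k))
        (Matrix.replicateRow Unit (ε • b + ν • w)) (Matrix.replicateCol Unit (ε • b + ν • w))
        (Δ + ε • C + ν • E) := by
  ext (i | i) (j | j) <;> simp

/-- The one-parameter family `D + ε M` in block form. [folklore] -/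
theorem fromBlocks_add_smul (Δ C : Matrix ι' ι' k) (a ε : k) (b : ι' → k) :
    Matrix.fromBlocks (0 : Matrix Unit Unit k) 0 0 Δ +
        ε • Matrix.fromBlocks (a • (1 : Matrix Unit Unit k)) (Matrix.replicateRow Unit b)
          (Matrix.replicateCol Unit b) C =
      Matrix.fromBlocks ((ε * a) • (1 : Matrix Unit Unit k))
        (Matrix.replicateRow Unit (ε • b)) (Matrix.replicateCol Unit (ε • b)) (Δ + ε • C) := by
  ext (i | i) (j | j) <;> simp

/-- Determinant of the block family with non-zero corner `c`: Schur complement,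
`det [[c, qᵀ], [q, S]] = c · det (S - c⁻¹ q qᵀ)`. [folklore] -/
theorem det_fromBlocks_corner [Fintype ι'] [DecidableEq ι'] {c : k} (hc : c ≠ 0) (q : ι' → k)
    (S : Matrix ι' ι' k) :
    (Matrix.fromBlocks (c • (1 : Matrix Unit Unit k)) (Matrix.replicateRow Unit q)
        (Matrix.replicateCol Unit q) S).det = c * (S - c⁻¹ • Matrix.vecMulVec q q).det := by
  rw [det_fromBlocks_smul_one₁₁ hc, Fintype.card_unit, pow_one, ← Matrix.vecMulVec_eq]

/-- `(ε u) (ε u)ᵀ` rescaled: `ε⁻¹ • vecMulVec (ε u) (ε u) = ε • vecMulVec u u`. [folklore] -/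
theorem inv_smul_vecMulVec_smul {ε : k} (hε : ε ≠ 0) (u : ι' → k) :
    ε⁻¹ • Matrix.vecMulVec (ε • u) (ε • u) = ε • Matrix.vecMulVec u u := by
  rw [Matrix.smul_vecMulVec, Matrix.vecMulVec_smul, smul_smul, smul_smul, inv_mul_cancel₀ hε,
    one_mul]

end Blocks

end Summit.ValiantsHypothesis.ValiantsHypothesis.Theorems.SymPencilHomogeneousDropTools

end
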